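import Mathlib
import Summits.ValiantsHypothesis.ValiantsHypothesis.Theorems.ValuativeGCTValuativeFlipSeedLift

/-!
# Explicit padded-permanent highest-weight vectors: certification at top-PURE points and the
# transport of two-row seeds from binary forms

Wall-breaker axis k5 ("explicit padded-permanent highest-weight vectors for `stub_seedRichness`") of
crux `ValuativeGCT.ValuativeFlip` (stmt-ValiantsHypothesis-12624), complementing the seed-lift
transfer of `ValuativeGCTValuativeFlipSeedLift(Per).lean` (`psl_*`, wall-breaker k9): there the lifted
seed `liftHWV n j F` is evaluated twist-free on padded `x_top`-LINEAR forms.  This file adds: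

* §1 **Top-pure forms.** If EVERY monomial of `q` has the same degree `r` in `x_top` (e.g.
  `q = x_top^{n-1} · y`), BIP's twist `coeff_e ↦ (e_top + j)!/e_top! · coeff_e` is the SCALAR
  `(r+j)!/r!`, so `(L F)(x_top^j q♯) = ((r+j)!/r!)^{deg F} · F(q)` for every form `F` on `Sym^n`
  (`aeval_paddedForm_liftHWV_of_topPure`) and the padded highest-weight vector `[L F]` is NONZERO in
  `ℂ[Δ_{n+j}(Q)]` as soon as `F(q) ≠ 0` at one top-pure `q` with `x_top^j q♯ ∈ End · Q`
  (`mk_liftHWV_ne_zero_of_topPure`).  Top-pure points reach seeds that vanish on all top-linear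
  forms (every seed of weight `μ*` with `μ₁ > deg`, e.g. all two-row seeds of degree `2`), which the
  `x_top`-linear certificates of `psl_seedLift_transfer` / `psl_paddedPer_seedLift` cannot see.
* §2 **Two-row weights.** The embedding `ι` of `Fin 2` onto the two greatest matrix indices
  (`exists_topTwoEmb`) transports highest-weight vectors of `ℂ[Sym^n ℂ²]` (semi-invariants of binary
  forms, `Literature/…/BinarySemiInvariants.lean`) to `ℂ[Sym^n ℂ^{n²}]`
  (`rename_mem_highestWeightSpace_coordRep`); `partitionWeightLex_eq_extend_pair` identifies the
  transported weight `extend ι (-b, -a) 0` with `partitionWeightLex n λ`, `λ = (a, b)`, and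
  `partitionWeightLex_rowLift_pair` identifies the lifted weight `(λ♯(n+j))*` with that of the
  two-row partition `(a + j·d, b)`, so that conclusions read in the crux's own weights
  `(Weight.dualOfPartition (m*m) λ).toMatIdx`.  (The padded End-points `x_top^j (B · per_n)♯` of
  `X₀₀^j per_n` are `psl_paddedForm_linSubst_per_mem_endOrbit` of `…SeedLiftPer.lean`.)

No definitions; sorry-free.  References: Bürgisser–Ikenmeyer–Panova 2019 §5 (Lemma 5.2, Thm 5.4);
Ikenmeyer–Panova 2017 Prop. 2.6(b); Mulmuley–Sohoni 2001 §4.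
-/

set_option linter.dupNamespace false

namespace Summit.ValiantsHypothesis.ValiantsHypothesis.Theorems.ValuativeFlip

open MvPolynomial
open scoped BigOperators Matrix
open Literature.NumberTheory.DiophantineGeometry Literature.Computability.AlgebraicComplexity
open Literature.Computability.Complexity (liftHWV paddedForm rowLift partitionWeightLex topMatIdx
  le_topMatIdx segEmb segEmb_strictMono segEmb_topMatIdx liftHWV_mem_highestWeightSpace
  aeval_formCoeff_paddedForm_liftHWV partitionWeightLex_apply getD_sortedParts_rowLift)

noncomputable section

/-! ## §1 Top-pure forms: the twist is a scalar, and nonvanishing of the padded vector -/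

/-- On a form all of whose monomials have degree `r` in `x_i`, BIP's twist factor
`(e_i + j)!/e_i!` is the constant `(r + j)!/r!` (coefficientwise). [BIP 2019 Lemma 5.2; folklore] -/
theorem twist_eq_descFactorial_mul_of_forall_apply_eq {σ : Type*} {q : MvPolynomial σ ℂ} (i : σ)
    {r : ℕ} (hq : ∀ e ∈ q.support, e i = r) (j : ℕ) (e : σ →₀ ℕ) :
    (((e i + j).descFactorial j : ℕ) : ℂ) * coeff e q =
      (((r + j).descFactorial j : ℕ) : ℂ) * coeff e q := by
  by_cases h : coeff e q = 0
  · rw [h, mul_zero, mul_zero]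
  · rw [hq e (mem_support_iff.mpr h)]

/-- **Values of a lifted form at padded top-PURE forms.**  For a form `F` of degree `δ` on
`ℂ[Sym^n ℂ^{n²}]` and a form `q` of degree `n` all of whose monomials have degree `r` in `x_top`:
`(L F)(x_top^j · q♯) = ((r+j)!/r!)^δ · F(q)` (`L = liftHWV n j`, `q♯ = q` on the final segment,
`paddedForm`).  BIP Thm 5.4 with Lemma 5.2 (`aeval_formCoeff_paddedForm_liftHWV`) and homogeneity.
No highest-weight hypothesis is needed. [BIP 2019 §5; this file] -/
theorem aeval_paddedForm_liftHWV_of_topPure (n j : ℕ) [NeZero n] [NeZero (n + j)]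
    {F : MvPolynomial (DegIdx (MatIdx n) n) ℂ} {δ : ℕ} (hFδ : F.IsHomogeneous δ)
    {q : MvPolynomial (MatIdx n) ℂ} (hq : q.IsHomogeneous n) {r : ℕ}
    (hqr : ∀ e ∈ q.support, e (topMatIdx n) = r) :
    aeval (formCoeff (n + j) (paddedForm n j q)) (liftHWV n j F) =
      ((((r + j).descFactorial j : ℕ) : ℂ)) ^ δ * aeval (formCoeff n q) F := by
  rw [aeval_formCoeff_paddedForm_liftHWV j hq F]
  have hfun : (fun e : DegIdx (MatIdx n) n =>
      (((e.1 (topMatIdx n) + j).descFactorial j : ℕ) : ℂ) * coeff e.1 q) =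
      fun e => (((r + j).descFactorial j : ℕ) : ℂ) • formCoeff n q e := by
    funext e
    rw [formCoeff_apply, smul_eq_mul]
    exact twist_eq_descFactorial_mul_of_forall_apply_eq (topMatIdx n) hqr j e.1
  rw [hfun]
  have hscale := algHom_apply_eq_pow_smul_of_isHomogeneous
    (aeval fun e : DegIdx (MatIdx n) n => (((r + j).descFactorial j : ℕ) : ℂ) • formCoeff n q e)
    (aeval (formCoeff n q)) (((r + j).descFactorial j : ℕ) : ℂ)
    (fun e => by rw [aeval_X, aeval_X]) hFδ
  rw [hscale, smul_eq_mul]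

/-- **Nonvanishing of the padded vector from one top-pure value.**  If `x_top^j · q♯` lies in the
endomorphism orbit of a form `Q` of degree `n + j` for a top-pure `q` with `F(q) ≠ 0`, then the
class of `liftHWV n j F` in `ℂ[Δ_{n+j}(Q)] = OrbitCoordRing Q (n+j)` is nonzero (the orbit ideal
vanishes at `End · Q`, `psl_aeval_formCoeff_linSubst_eq_zero_of_mem`). [this file] -/
theorem mk_liftHWV_ne_zero_of_topPure (n j : ℕ) [NeZero n] [NeZero (n + j)]
    {F : MvPolynomial (DegIdx (MatIdx n) n) ℂ} {δ : ℕ} (hFδ : F.IsHomogeneous δ)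
    (Q : MvPolynomial (MatIdx (n + j)) ℂ) {q : MvPolynomial (MatIdx n) ℂ} (hq : q.IsHomogeneous n)
    {r : ℕ} (hqr : ∀ e ∈ q.support, e (topMatIdx n) = r)
    (hmem : paddedForm n j q ∈ endOrbit (MatIdx (n + j)) ℂ Q) (hval : aeval (formCoeff n q) F ≠ 0) :
    Ideal.Quotient.mk (orbitVanishingIdeal Q (n + j)) (liftHWV n j F) ≠ 0 := by
  intro h0
  rw [Ideal.Quotient.eq_zero_iff_mem] at h0
  obtain ⟨M, hM⟩ := hmem
  have hvan := psl_aeval_formCoeff_linSubst_eq_zero_of_mem h0 M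
  dsimp only at hM
  rw [hM, aeval_paddedForm_liftHWV_of_topPure n j hFδ hq hqr] at hvan
  exact (mul_ne_zero (pow_ne_zero _ (Nat.cast_ne_zero.mpr (descFactorial_add_pos r j).ne')) hval) hvan

/-! ## §2 Two-row weights: the top-two embedding and the dictionary with `partitionWeightLex` -/

/-- **The embedding of `Fin 2` onto the two greatest matrix indices** (positions `n² - 2 < n² - 1` of
the lexicographic enumeration; `n ≥ 2`): strictly monotone, with upper-set image, sending `1` to the
top index. [folklore] -/
theorem exists_topTwoEmb (n : ℕ) [NeZero n] (hn : 2 ≤ n) :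
    ∃ ι : Fin 2 → MatIdx n, StrictMono ι ∧ IsUpperSet (Set.range ι) ∧ ι 1 = topMatIdx n ∧
      (((matIdxEquiv n).symm (ι 0) : Fin (n * n)) : ℕ) = n * n - 2 := by
  have h4 : 4 ≤ n * n := Nat.mul_le_mul hn hn
  let ι : Fin 2 → MatIdx n := fun i => matIdxEquiv n ⟨n * n - 2 + (i : ℕ), by have := i.2; omega⟩
  refine ⟨ι, ?_, ?_, ?_, ?_⟩
  · intro i j hij
    change matIdxEquiv n _ < matIdxEquiv n _
    rw [OrderIso.lt_iff_lt, Fin.lt_def]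
    exact Nat.add_lt_add_left (Fin.lt_def.mp hij) _
  · rintro y y' hyy' ⟨i, rfl⟩
    have hle : (((matIdxEquiv n).symm (ι i) : Fin (n * n)) : ℕ) ≤ ((matIdxEquiv n).symm y' : ℕ) :=
      Fin.le_def.mp ((OrderIso.le_iff_le _).mpr hyy')
    change (((matIdxEquiv n).symm (matIdxEquiv n _) : Fin (n * n)) : ℕ) ≤ _ at hle
    rw [OrderIso.symm_apply_apply] at hle
    simp only at hle
    have hy' := ((matIdxEquiv n).symm y').2
    refine ⟨⟨((matIdxEquiv n).symm y' : ℕ) - (n * n - 2), by omega⟩, ?_⟩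
    apply (matIdxEquiv n).symm.injective
    change (matIdxEquiv n).symm (matIdxEquiv n _) = _
    rw [OrderIso.symm_apply_apply]
    apply Fin.ext
    simp only
    omega
  · change matIdxEquiv n _ = matIdxEquiv n _
    congr 1
    apply Fin.ext
    simp only [Fin.val_one]
    omega
  · change (((matIdxEquiv n).symm (matIdxEquiv n _) : Fin (n * n)) : ℕ) = _
    rw [OrderIso.symm_apply_apply]
    simp

/-- The sorted parts of a two-part partition. [folklore] -/
theorem sortedParts_eq_pair {N : ℕ} {lam : Nat.Partition N} {a b : ℕ} (hab : b ≤ a)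
    (h : lam.parts = {a, b}) : lam.sortedParts = [a, b] := by
  change lam.parts.sort (· ≥ ·) = _
  rw [h, show ({a, b} : Multiset ℕ) = (↑[a, b] : Multiset ℕ) from rfl, Multiset.coe_sort]
  exact List.mergeSort_eq_self _ (by simpa using hab)

/-- **Two-row weights are transported binary-form weights.**  For the top-two embedding `ι`
(`ι 1 = top`, `ι 0` at position `n² - 2`) and a partition `λ` with parts `{a, b}`, `b ≤ a`:
`partitionWeightLex n λ = extend ι (-b, -a) 0` — the weight `λ* = (0, …, 0, -b, -a)` of the crux's
conventions is the binary-form weight `(-b, -a)` placed on the two greatest indices. [folklore] -/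
theorem partitionWeightLex_eq_extend_pair {n : ℕ} [NeZero n] {ι : Fin 2 → MatIdx n}
    (hι : StrictMono ι) (hι1 : ι 1 = topMatIdx n)
    (hι0 : (((matIdxEquiv n).symm (ι 0) : Fin (n * n)) : ℕ) = n * n - 2)
    {N : ℕ} (lam : Nat.Partition N) {a b : ℕ} (hab : b ≤ a) (hlam : lam.parts = {a, b}) :
    partitionWeightLex n lam = Function.extend ι ![-(b : ℤ), -(a : ℤ)] 0 := by
  have hsp := sortedParts_eq_pair hab hlam
  have htop : (((matIdxEquiv n).symm (topMatIdx n) : Fin (n * n)) : ℕ) = n * n - 1 := by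
    rw [topMatIdx, OrderIso.symm_apply_apply]
  funext y
  rw [partitionWeightLex_apply, hsp]
  have hy : y = matIdxEquiv n ((matIdxEquiv n).symm y) := ((matIdxEquiv n).apply_symm_apply y).symm
  have hlt : (((matIdxEquiv n).symm y : Fin (n * n)) : ℕ) < n * n := ((matIdxEquiv n).symm y).2
  by_cases h1 : (((matIdxEquiv n).symm y : Fin (n * n)) : ℕ) = n * n - 1
  · -- `y = top = ι 1`
    have hyt : y = ι 1 := by
      rw [hι1, hy, topMatIdx]
      congr 1
      exact Fin.ext h1
    rw [h1, hyt, hι.injective.extend_apply, show n * n - (n * n - 1 + 1) = 0 by omega]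
    simp
  by_cases h2 : (((matIdxEquiv n).symm y : Fin (n * n)) : ℕ) = n * n - 2
  · -- `y = ι 0`
    have hy0 : y = ι 0 := by
      rw [hy, ← (matIdxEquiv n).apply_symm_apply (ι 0)]
      congr 1
      exact Fin.ext (h2.trans hι0.symm)
    rw [h2, hy0, hι.injective.extend_apply, show n * n - (n * n - 2 + 1) = 1 by omega]
    simp
  · -- `y` below the top two indices
    have hyn : ¬ ∃ i, ι i = y := by
      rintro ⟨⟨i, hi2⟩, hi⟩
      have hpos : (((matIdxEquiv n).symm (ι ⟨i, hi2⟩) : Fin (n * n)) : ℕ) =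
          (((matIdxEquiv n).symm y : Fin (n * n)) : ℕ) := by rw [hi]
      rcases i with _ | _ | i
      · exact h2 (hpos.symm.trans hι0)
      · exact h1 (hpos.symm.trans (by rw [← htop, ← hι1]; rfl))
      · omega
    rw [Function.extend_apply' _ _ _ hyn, Pi.zero_apply]
    have hge : 2 ≤ n * n - ((((matIdxEquiv n).symm y : Fin (n * n)) : ℕ) + 1) := by omega
    obtain ⟨t, ht⟩ := Nat.exists_eq_add_of_le hge
    rw [ht, show 2 + t = t + 2 by ring]
    simp

/-- **The lifted two-row weight.**  If `λ₂ ⊢ n·d` has parts `{a, b}` and `λ ⊢ (n+j)·d` has parts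
`{a + j·d, b}` (`b ≤ a`), then `partitionWeightLex (n+j) (λ₂♯(n+j)) = partitionWeightLex (n+j) λ`:
the Kadish–Landsberg lift adds `j·d` boxes to the first row (`getD_sortedParts_rowLift`). [folklore] -/
theorem partitionWeightLex_rowLift_pair {n d j : ℕ} (lam₂ : Nat.Partition (n * d))
    (lam : Nat.Partition ((n + j) * d)) {a b : ℕ} (hab : b ≤ a) (h₂ : lam₂.parts = {a, b})
    (h : lam.parts = {a + j * d, b}) :
    partitionWeightLex (n + j) (rowLift lam₂ j) = partitionWeightLex (n + j) lam := by
  have hsp₂ := sortedParts_eq_pair hab h₂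
  have hsp := sortedParts_eq_pair (hab.trans (Nat.le_add_right a _)) h
  funext y
  rw [partitionWeightLex_apply, partitionWeightLex_apply, getD_sortedParts_rowLift, hsp₂, hsp]
  congr 2
  rcases ((n + j) * (n + j) - ((((matIdxEquiv (n + j)).symm y : Fin _) : ℕ) + 1)) with _ | _ | r
  · simp
  · simp
  · simp

end

end Summit.ValiantsHypothesis.ValiantsHypothesis.Theorems.ValuativeFlip
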